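import Summits.Ventures.GridStability.Models.InverterNetworkVoltagePH
import Summits.Ventures.GridStability.Models.PortHamiltonianSpectrum
import Summits.Ventures.GridStability.Models.DroopQVData

/-!
# GridStability/Models/DroopQVPortHamiltonianSpectrum — the SOLVER-FREE small-signal theorem of rung G3.b, any `n`: a positive SEMIdefinite Hessian pattern excludes open right-half-plane modes of the droop microgrid WITH Q–V voltage dynamics

Cell `gridfusion` (LADDER-GRIDFUSION, APEX LINE rung G3.b «droop microgrid with Q–V voltage dynamics»; seat
gridfusion-model-8 (g0); announced to lead g5 2026-08-27T09:3xZ as «G3.b-ss-PH-THM»-candidate). Composition of three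
kernel facts: model-3's port-Hamiltonian spectral lemma (`Models/PortHamiltonianSpectrum.lean` p515239,
`re_eig_nonpos_of_pH`: `A = (J − R)Q`, `J` skew, `R ⪰ 0`, `Q ≻ 0` ⇒ `Re μ ≤ 0`), the factorisation
`jacMatrix (θ, V) = (𝒥 − ℛ(V))·𝒬(θ, V)` of `Models/InverterNetworkVoltagePH.lean` (p518103) and the `3n × 3n`
linearisation of `Models/InverterNetworkVoltageLinearisation.lean` (p515264). Two additions make it USABLE:
* §1 `re_eig_nonpos_of_pH_psd` — the pH lemma with `Q` only positive SEMIdefinite (the rotation mode `[1; 0; 0]`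
  lies in `ker 𝒬`, so `𝒬 ≻ 0` never holds for a microgrid; with `Q ⪰ 0`: either `Q v = 0`, then `A v = 0` and `μ = 0`,
  or `v*Qv > 0` and the original argument runs) — every eigenvalue has `Re μ ≤ 0`;
* §2 `posSemidef_of_posDef_add_rankOne` — LIFTING: `Xᵀ = X`, `X r = 0`, `X + c·r rᵀ ≻ 0` ⇒ `X ⪰ 0`; so an
  instance certifies `𝒬(θ*, V*) ⪰ 0` by ONE integer Gram certificate of the positive definite rational matrix
  `𝒬 + r rᵀ` — no Lyapunov solve, no SDP;
* §3 `DroopMicrogrid.re_eig_nonpos_of_hessQ` — **THE FAMILY THEOREM**: for model N1 ([cite: KunduEtAl2019, eqs. (4a)–(4c)])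
  with `k_P, τ_P, k_Q ≠ 0`, `k_P/τ_P² ≥ 0`, `k_Q V/τ_Q ≥ 0`, at any state `(θ, V)` with `V_i ≠ 0` whose Hessian
  pattern `hessQ (θ, V)` is positive semidefinite, EVERY complex eigenpair of `jacMatrix (θ, V)` has `Re μ ≤ 0`
  (kernel form of the linearised content of [cite: ShinZavala2020, Prop. 1] «an equilibrium with `∇²H ≻ 0` on the
  rotation complement is locally asymptotically stable» — here only the spectral half-plane statement, no flow word);
  `hessQ_mulVec_rotation` (`𝒬 [1; 0; 0] = 0`) for the lifting; §4 `DroopQVData.hessQQ` / `hessQ_eq` — the ℚ-twin of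
  `𝒬(θ*, V*)` for exact instances.
THREE COLUMNS. CERTIFIED (kernel, this file): a theorem about the MATRIX `jacMatrix` of the MODEL N1, any `n`; the
per-instance input is one PSD fact. MODELLED: MV-6N + MV-6D. VALIDATED: nothing. It is weaker than the point lane
(`Re z < −r`, `Models/WSCC9DroopQVPoint.lean`) and says nothing about rates; no sentence of this file says a converter
or a microgrid is stable.
-/

noncomputable section

open Real Matrix Finset
open scoped ComplexOrder ComplexConjugate

namespace Summit.Ventures.GridStability.Models

/-! ## §1 The port-Hamiltonian lemma with a positive SEMIdefinite `Q` -/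

section PH

variable {ι : Type*} [Fintype ι] [DecidableEq ι]

/-- The complexification of a real positive semidefinite matrix is positive semidefinite. [folklore] -/
theorem posSemidef_map_ofReal {R : Matrix ι ι ℝ} (hR : R.PosSemidef) : (R.map ((↑) : ℝ → ℂ)).PosSemidef := by
  open scoped MatrixOrder in
  obtain ⟨B, hB⟩ := CStarAlgebra.nonneg_iff_eq_star_mul_self.mp hR.nonneg
  have : R.map ((↑) : ℝ → ℂ) = R.map Complex.ofRealHom := rfl
  rw [this, hB, Matrix.star_eq_conjTranspose, Matrix.map_mul, Matrix.conjTranspose_map _ (fun a => by simp)]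
  exact Matrix.posSemidef_conjTranspose_mul_self _

/-- **Port-Hamiltonian linearisation with a SEMIdefinite energy Hessian: no mode in the open right half-plane.**
`A = (J − R) Q` with `J` real skew, `R ⪰ 0`, `Q ⪰ 0` ⇒ every complex eigenpair `A v = μ v`, `v ≠ 0`, has `Re μ ≤ 0`
(if `Q v = 0` then `μ = 0`; otherwise `v*Qv > 0` and `Re μ · v*Qv = −(Qv)*R(Qv) ≤ 0`). [folklore] -/
theorem re_eig_nonpos_of_pH_psd {J R Q : Matrix ι ι ℝ} (hJ : Jᵀ = -J) (hR : R.PosSemidef) (hQ : Q.PosSemidef)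
    {μ : ℂ} {v : ι → ℂ} (hv : v ≠ 0) (hAv : ((J - R) * Q).map ((↑) : ℝ → ℂ) *ᵥ v = μ • v) :
    μ.re ≤ 0 := by
  have hQs : Qᵀ = Q := by
    have h := hQ.isHermitian
    rw [Matrix.IsHermitian, Matrix.conjTranspose_eq_transpose_of_trivial] at h
    exact h
  set u : ι → ℂ := Q.map ((↑) : ℝ → ℂ) *ᵥ v with hudef
  set q : ℂ := star v ⬝ᵥ u with hqdef
  have hmul : ((J - R) * Q).map ((↑) : ℝ → ℂ) *ᵥ v = (J - R).map ((↑) : ℝ → ℂ) *ᵥ u := by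
    rw [hudef, Matrix.mulVec_mulVec]
    congr 1
    ext a b
    simp only [Matrix.map_apply, Matrix.mul_apply]
    push_cast
    rfl
  have hQC := posSemidef_map_ofReal hQ
  by_cases hu : u = 0
  · -- `Q v = 0`: then `A v = 0`, so `μ = 0`
    have hA0 : μ • v = 0 := by rw [← hAv, hmul, hu, Matrix.mulVec_zero]
    rcases smul_eq_zero.1 hA0 with h | h
    · simp [h]
    · exact absurd h hv
  · have hq0 : 0 ≤ q := hQC.dotProduct_mulVec_nonneg v
    have hqne : q ≠ 0 := by
      intro h0
      exact hu ((hQC.dotProduct_mulVec_zero_iff v).1 h0)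
    have hqpos : 0 < q := lt_of_le_of_ne hq0 (Ne.symm hqne)
    obtain ⟨hqre, hqim⟩ := Complex.pos_iff.1 hqpos
    have hkey : μ * q = star u ⬝ᵥ ((J - R).map ((↑) : ℝ → ℂ) *ᵥ u) := by
      have h1 : star v ⬝ᵥ (Q.map ((↑) : ℝ → ℂ) *ᵥ (((J - R) * Q).map ((↑) : ℝ → ℂ) *ᵥ v)) = μ * q := by
        rw [hAv, Matrix.mulVec_smul, dotProduct_smul, smul_eq_mul]
      rw [← h1, star_dotProduct_map_mulVec_symm hQs, ← hudef, hmul]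
    have hsplit : (J - R).map ((↑) : ℝ → ℂ) = J.map ((↑) : ℝ → ℂ) - R.map ((↑) : ℝ → ℂ) := by
      ext a b; simp
    rw [hsplit, Matrix.sub_mulVec, dotProduct_sub] at hkey
    have hJ0 := re_star_dotProduct_skew_eq_zero hJ u
    have hR0 : 0 ≤ star u ⬝ᵥ (R.map ((↑) : ℝ → ℂ) *ᵥ u) := dotProduct_map_ofReal_mulVec_nonneg hR u
    obtain ⟨hRre, -⟩ := Complex.nonneg_iff.1 hR0
    have hre := congr_arg Complex.re hkey
    have hq : q = (q.re : ℂ) := Complex.ext (by simp) (by simp [← hqim])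
    rw [hq, Complex.sub_re, hJ0] at hre
    simp only [Complex.mul_re, Complex.ofReal_re, Complex.ofReal_im, mul_zero, sub_zero] at hre
    nlinarith

/-! ## §2 Lifting a rank-one-corrected positive definite certificate to `⪰ 0` on a matrix with a known kernel vector -/

omit [DecidableEq ι] in
/-- **Lifting lemma.** `X` real symmetric with `X r = 0`; if `X + c·r rᵀ` is positive definite for some real `c` then
`X ⪰ 0`: for `w = v − (rᵀv/rᵀr)·r` one has `Xv = Xw`, `rᵀw = 0` and `vᵀXv = wᵀXw = wᵀ(X + c r rᵀ)w ≥ 0`.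
(The instance certificate of the solver-free lane: one PD check of `𝒬 + r rᵀ`.) [folklore] -/
theorem posSemidef_of_posDef_add_rankOne {X : Matrix ι ι ℝ} (hX : Xᵀ = X) {r : ι → ℝ} (hr : X *ᵥ r = 0)
    {c : ℝ} (hP : (X + c • Matrix.vecMulVec r r).PosDef) : X.PosSemidef := by
  refine Matrix.PosSemidef.of_dotProduct_mulVec_nonneg ?_ fun v => ?_
  · rw [Matrix.IsHermitian, Matrix.conjTranspose_eq_transpose_of_trivial, hX]
  · simp only [star_trivial]
    by_cases hr0 : r ⬝ᵥ r = 0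
    · -- `r = 0`: then `X = X + c r rᵀ` restricted… simply use the PD matrix: `vᵀ(X + c rrᵀ)v = vᵀXv + c (rᵀv)² ` and `r = 0`
      have hrz : r = 0 := by
        have : ∀ i, r i * r i = 0 := by
          have hs : ∑ i, r i * r i = 0 := hr0
          have hnn : ∀ i ∈ Finset.univ, 0 ≤ r i * r i := fun i _ => mul_self_nonneg (r i)
          exact fun i => (Finset.sum_eq_zero_iff_of_nonneg hnn).1 hs i (Finset.mem_univ i)
        funext i
        exact mul_self_eq_zero.1 (this i)
      have h := hP.posSemidef.dotProduct_mulVec_nonneg v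
      simp only [star_trivial, hrz] at h
      have hz : (c • Matrix.vecMulVec (0 : ι → ℝ) 0) *ᵥ v = 0 := by
        funext i; simp [Matrix.mulVec, dotProduct]
      rw [Matrix.add_mulVec, dotProduct_add, hz, dotProduct_zero, add_zero] at h
      exact h
    · set t : ℝ := (r ⬝ᵥ v) / (r ⬝ᵥ r) with htdef
      set w : ι → ℝ := v - t • r with hwdef
      have hrw : r ⬝ᵥ w = 0 := by
        rw [hwdef, dotProduct_sub, dotProduct_smul, smul_eq_mul, htdef]
        field_simp
        ring
      have hXw : X *ᵥ w = X *ᵥ v := by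
        rw [hwdef, Matrix.mulVec_sub, Matrix.mulVec_smul, hr, smul_zero, sub_zero]
      -- vᵀXv = wᵀXw (symmetry)
      have hsym : ∀ a b : ι → ℝ, a ⬝ᵥ (X *ᵥ b) = b ⬝ᵥ (X *ᵥ a) := by
        intro a b
        rw [Matrix.dotProduct_mulVec, ← Matrix.mulVec_transpose, hX, dotProduct_comm]
      have h1 : v ⬝ᵥ (X *ᵥ v) = w ⬝ᵥ (X *ᵥ w) := by
        rw [← hXw, hsym v w, hXw]
      have h2 : w ⬝ᵥ ((X + c • Matrix.vecMulVec r r) *ᵥ w) = w ⬝ᵥ (X *ᵥ w) := by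
        rw [Matrix.add_mulVec, dotProduct_add, Matrix.smul_mulVec, dotProduct_smul]
        have : Matrix.vecMulVec r r *ᵥ w = (r ⬝ᵥ w) • r := by
          funext i
          simp [Matrix.mulVec, Matrix.vecMulVec_apply, dotProduct, Finset.mul_sum, mul_comm, mul_assoc]
        rw [this, hrw, zero_smul, dotProduct_zero, smul_zero, add_zero]
      have h3 := hP.posSemidef.dotProduct_mulVec_nonneg w
      simp only [star_trivial] at h3
      rw [h1, ← h2]
      exact h3

end PH

/-! ## §3 The family theorem for the droop microgrid with voltage dynamics -/

namespace DroopMicrogrid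

variable {n : ℕ} (mg : DroopMicrogrid n)

/-- The rotation mode is in the kernel of the Hessian pattern: `𝒬(θ, V) [1; 0; 0] = 0`. [folklore] -/
theorem hessQ_mulVec_rotation (θ V : Fin n → ℝ) :
    mg.hessQ θ V *ᵥ Sum.elim (fun _ => (1 : ℝ)) (Sum.elim 0 0) = 0 := by
  rw [hessQ, block3, Matrix.fromBlocks_mulVec, Matrix.fromBlocks_mulVec, Matrix.fromRows_mulVec,
    Matrix.fromCols_mulVec]
  simp only [Sum.elim_comp_inl, Sum.elim_comp_inr, Matrix.mulVec_zero, add_zero, Matrix.zero_mulVec,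
    Pθ_mulVec_one, ← Matrix.mulVec_mulVec, Qθ_mulVec_one]
  funext k
  rcases k with i | i | i <;> simp

/-- **THE FAMILY THEOREM (solver-free small-signal lane of rung G3.b, any `n`).** For the droop microgrid WITH Q–V
voltage dynamics (model N1) with `k_Pi, τ_Pi, k_Qi ≠ 0`, `k_Pi/τ_Pi² ≥ 0`, `k_Qi V_i/τ_Qi ≥ 0`: at every state `(θ, V)`
with all `V_i ≠ 0` at which the Hessian pattern `𝒬(θ, V)` is positive SEMIdefinite, every complex eigenpair
`(μ, v)` of the `3n × 3n` Jacobian `jacMatrix (θ, V)` has `Re μ ≤ 0` — no mode in the open right half-plane. (At a rest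
point of a lossless reciprocal network `𝒬` is the Hessian of the Hamiltonian (10); the per-instance input is ONE PSD
certificate.) CERTIFIED: matrix statement about the MODEL; MODELLED: MV-6N + MV-6D; kernel form of the linearised
content of [cite: ShinZavala2020, Prop. 1]; model [cite: KunduEtAl2019, eqs. (4a)–(4c)]. No stability sentence. -/
theorem re_eig_nonpos_of_hessQ (θ V : Fin n → ℝ) (hkP : ∀ i, mg.kP i ≠ 0) (hτP : ∀ i, mg.τP i ≠ 0)
    (hkQ : ∀ i, mg.kQ i ≠ 0) (hV : ∀ i, V i ≠ 0) (hRP : ∀ i, 0 ≤ mg.kP i / mg.τP i ^ 2)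
    (hRQ : ∀ i, 0 ≤ mg.kQ i * V i / mg.τQ i) (hQ : (mg.hessQ θ V).PosSemidef)
    {μ : ℂ} {v : Fin n ⊕ (Fin n ⊕ Fin n) → ℂ} (hv : v ≠ 0)
    (hJv : (mg.jacMatrix θ V).map ((↑) : ℝ → ℂ) *ᵥ v = μ • v) : μ.re ≤ 0 := by
  rw [mg.jacMatrix_eq_pH θ V hkP hτP hkQ hV] at hJv
  exact re_eig_nonpos_of_pH_psd mg.phJ_transpose (mg.phR_posSemidef V hRP hRQ) hQ hv hJv

/-- **Instance form**: the PSD input supplied through the lifting lemma — `𝒬(θ, V) + c·r rᵀ ≻ 0` for the rotation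
vector `r = [1; 0; 0]` and some real `c` (plus symmetry of `𝒬`, e.g. `hessQ_transpose`). [folklore] -/
theorem re_eig_nonpos_of_hessQ_add_rankOne (θ V : Fin n → ℝ) (hkP : ∀ i, mg.kP i ≠ 0) (hτP : ∀ i, mg.τP i ≠ 0)
    (hkQ : ∀ i, mg.kQ i ≠ 0) (hV : ∀ i, V i ≠ 0) (hRP : ∀ i, 0 ≤ mg.kP i / mg.τP i ^ 2)
    (hRQ : ∀ i, 0 ≤ mg.kQ i * V i / mg.τQ i) (hsymm : (mg.hessQ θ V)ᵀ = mg.hessQ θ V) {c : ℝ}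
    (hP : (mg.hessQ θ V + c • Matrix.vecMulVec (Sum.elim (fun _ => (1 : ℝ)) (Sum.elim 0 0))
      (Sum.elim (fun _ => (1 : ℝ)) (Sum.elim 0 0))).PosDef)
    {μ : ℂ} {v : Fin n ⊕ (Fin n ⊕ Fin n) → ℂ} (hv : v ≠ 0)
    (hJv : (mg.jacMatrix θ V).map ((↑) : ℝ → ℂ) *ᵥ v = μ • v) : μ.re ≤ 0 :=
  mg.re_eig_nonpos_of_hessQ θ V hkP hτP hkQ hV hRP hRQ
    (posSemidef_of_posDef_add_rankOne hsymm (mg.hessQ_mulVec_rotation θ V) hP) hv hJv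

end DroopMicrogrid

/-! ## §4 The ℚ-twin of the Hessian pattern at an exact operating point -/

namespace DroopQVData

variable {n : ℕ} (d : DroopQVData n)

/-- ℚ-twin of `𝒬(θ*, V*)` (blocks `PθQ`, `PVQ`, `diag(V)⁻¹QθQ`, `diag(τ_P/k_P)`, `diag(V)⁻¹(QVQ + diag(k_Q)⁻¹)`). [folklore] -/
def hessQQ : Matrix (Fin (n + 1) ⊕ (Fin (n + 1) ⊕ Fin (n + 1))) (Fin (n + 1) ⊕ (Fin (n + 1) ⊕ Fin (n + 1))) ℚ :=
  Matrix.fromBlocks d.PθQ (Matrix.fromCols 0 d.PVQ)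
    (Matrix.fromRows 0 (Matrix.diagonal (fun i => (d.V i)⁻¹) * d.QθQ))
    (Matrix.fromBlocks (Matrix.diagonal fun i => d.τP i / d.kP i) 0
      0 (Matrix.diagonal (fun i => (d.V i)⁻¹) * (d.QVQ + Matrix.diagonal fun i => (d.kQ i)⁻¹)))

/-- **Bridge**: the real Hessian pattern of `M′` at `(θ*, V*)` IS `hessQQ` cast. [folklore] -/
theorem hessQ_eq (hcirc : ∀ i, d.s i ^ 2 + d.c i ^ 2 = 1) :
    d.toMicrogrid.hessQ d.angleOf d.Vstar = d.hessQQ.map ((↑) : ℚ → ℝ) := by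
  rw [DroopMicrogrid.hessQ, DroopMicrogrid.block3, hessQQ, d.Pθ_eq hcirc, d.PV_eq hcirc, d.Qθ_eq hcirc,
    d.QV_eq hcirc]
  ext (i | i | i) (j | j | j) <;>
    simp [Matrix.fromBlocks, Matrix.fromCols, Matrix.fromRows, Matrix.diagonal_apply, Matrix.add_apply,
      toMicrogrid, net, Vstar, apply_ite ((↑) : ℚ → ℝ)]

end DroopQVData

/-! ## §5 (append 2026-08-27, model-8 g0) The SEMIdefinite form of the lifting lemma — input shape of the rounded-twin lane

For large instances the exact matrix `𝒬 + r rᵀ` has high rational height; lit-5's rounded-twin lane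
(`Literature/Computation/Certificates/PsdRoundedTwin.lean`, `PSD.quadForm_nonneg_of_roundedTwin`) certifies only that its
quadratic form is NONNEGATIVE. That is enough: the lifting argument never used definiteness. -/

section PHpsd

variable {ι : Type*} [Fintype ι]

/-- **Lifting lemma, semidefinite input.** `X` real symmetric with `X r = 0`; if `X + c·r rᵀ ⪰ 0` for some real `c` then
`X ⪰ 0` (same proof as `posSemidef_of_posDef_add_rankOne`: `vᵀXv = wᵀ(X + c r rᵀ)w` for `w = v − (rᵀv/rᵀr)·r`). [folklore] -/
theorem posSemidef_of_posSemidef_add_rankOne {X : Matrix ι ι ℝ} (hX : Xᵀ = X) {r : ι → ℝ} (hr : X *ᵥ r = 0)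
    {c : ℝ} (hP : (X + c • Matrix.vecMulVec r r).PosSemidef) : X.PosSemidef := by
  refine Matrix.PosSemidef.of_dotProduct_mulVec_nonneg ?_ fun v => ?_
  · rw [Matrix.IsHermitian, Matrix.conjTranspose_eq_transpose_of_trivial, hX]
  · simp only [star_trivial]
    by_cases hr0 : r ⬝ᵥ r = 0
    · have hrz : r = 0 := by
        have : ∀ i, r i * r i = 0 := by
          have hs : ∑ i, r i * r i = 0 := hr0
          have hnn : ∀ i ∈ Finset.univ, 0 ≤ r i * r i := fun i _ => mul_self_nonneg (r i)
          exact fun i => (Finset.sum_eq_zero_iff_of_nonneg hnn).1 hs i (Finset.mem_univ i)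
        funext i
        exact mul_self_eq_zero.1 (this i)
      have h := hP.dotProduct_mulVec_nonneg v
      simp only [star_trivial, hrz] at h
      have hz : (c • Matrix.vecMulVec (0 : ι → ℝ) 0) *ᵥ v = 0 := by
        funext i; simp [Matrix.mulVec, dotProduct]
      rw [Matrix.add_mulVec, dotProduct_add, hz, dotProduct_zero, add_zero] at h
      exact h
    · set t : ℝ := (r ⬝ᵥ v) / (r ⬝ᵥ r) with htdef
      set w : ι → ℝ := v - t • r with hwdef
      have hrw : r ⬝ᵥ w = 0 := by
        rw [hwdef, dotProduct_sub, dotProduct_smul, smul_eq_mul, htdef]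
        field_simp
        ring
      have hXw : X *ᵥ w = X *ᵥ v := by
        rw [hwdef, Matrix.mulVec_sub, Matrix.mulVec_smul, hr, smul_zero, sub_zero]
      have hsym : ∀ a b : ι → ℝ, a ⬝ᵥ (X *ᵥ b) = b ⬝ᵥ (X *ᵥ a) := by
        intro a b
        rw [Matrix.dotProduct_mulVec, ← Matrix.mulVec_transpose, hX, dotProduct_comm]
      have h1 : v ⬝ᵥ (X *ᵥ v) = w ⬝ᵥ (X *ᵥ w) := by
        rw [← hXw, hsym v w, hXw]
      have h2 : w ⬝ᵥ ((X + c • Matrix.vecMulVec r r) *ᵥ w) = w ⬝ᵥ (X *ᵥ w) := by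
        rw [Matrix.add_mulVec, dotProduct_add, Matrix.smul_mulVec, dotProduct_smul]
        have : Matrix.vecMulVec r r *ᵥ w = (r ⬝ᵥ w) • r := by
          funext i
          simp [Matrix.mulVec, Matrix.vecMulVec_apply, dotProduct, Finset.mul_sum, mul_comm, mul_assoc]
        rw [this, hrw, zero_smul, dotProduct_zero, smul_zero, add_zero]
      have h3 := hP.dotProduct_mulVec_nonneg w
      simp only [star_trivial] at h3
      rw [h1, ← h2]
      exact h3

end PHpsd

namespace DroopMicrogrid

variable {n : ℕ} (mg : DroopMicrogrid n)

/-- **Instance form, semidefinite input** (for rounded-twin certificates): `𝒬(θ, V) + c·r rᵀ ⪰ 0` for the rotation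
vector `r = [1; 0; 0]` and some real `c` (plus symmetry of `𝒬`) ⇒ every eigenpair of `jacMatrix (θ, V)` has `Re μ ≤ 0`.
[folklore] -/
theorem re_eig_nonpos_of_hessQ_add_rankOne_psd (θ V : Fin n → ℝ) (hkP : ∀ i, mg.kP i ≠ 0) (hτP : ∀ i, mg.τP i ≠ 0)
    (hkQ : ∀ i, mg.kQ i ≠ 0) (hV : ∀ i, V i ≠ 0) (hRP : ∀ i, 0 ≤ mg.kP i / mg.τP i ^ 2)
    (hRQ : ∀ i, 0 ≤ mg.kQ i * V i / mg.τQ i) (hsymm : (mg.hessQ θ V)ᵀ = mg.hessQ θ V) {c : ℝ}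
    (hP : (mg.hessQ θ V + c • Matrix.vecMulVec (Sum.elim (fun _ => (1 : ℝ)) (Sum.elim 0 0))
      (Sum.elim (fun _ => (1 : ℝ)) (Sum.elim 0 0))).PosSemidef)
    {μ : ℂ} {v : Fin n ⊕ (Fin n ⊕ Fin n) → ℂ} (hv : v ≠ 0)
    (hJv : (mg.jacMatrix θ V).map ((↑) : ℝ → ℂ) *ᵥ v = μ • v) : μ.re ≤ 0 :=
  mg.re_eig_nonpos_of_hessQ θ V hkP hτP hkQ hV hRP hRQ
    (posSemidef_of_posSemidef_add_rankOne hsymm (mg.hessQ_mulVec_rotation θ V) hP) hv hJv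

end DroopMicrogrid

end Summit.Ventures.GridStability.Models

end
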